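import Summits.QuantumAdvantage.AdviceFreeQNC0.FibreDecimation37ParityCount
import HarnessLib

/-!
# Cell qa-qnc0, `p = 3` — ROUND-37P2 File B, STEP 3 (the `L¹` form, hypothesis (Gen_d)): the parity of a family of MOD-3 tests on a
# parity class under a MINIMUM-DISTANCE hypothesis on the decimated code

Planner qa-qnc0-p2 g37, ROUND-37P2 §2, STEP 3 of Theorem 37.F (constant targets): tests `[ℓ_k(u) ∈ A_k]` on `{0,1}^ι` (`ι ≠ ∅`),
trivial off `J` (`A_k = ∅`), genuine at `k₀`; if every non-zero pattern `s` supported on `J` combines to a form of weight `≥ d`, and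
`(5/3)^{|J|}·(2^{−d} + (√3/2)^{|ι|}) ≤ 1/20`, then on either parity class the parity of the number of firing tests is prescribed
on at most `(3/4)·2^{|ι|−1}` points (`card_parityClass_filter_le_of_spread`).  `L¹` route: `Σ_s|ĉ_s| ≤ (5/3)^{|J|}`
(`sum_prod_norm_fcoef_le`), untwisted coin factor `‖1+χ₃(j)‖ ≤ 1` (`2^{n−wt}`), twisted factor `√3` and the zero pattern / any
zero coordinate kills the twisted product (`prod_norm_twist_one_le`).  Companion of the Parseval form `card_parityClass_filter_le`.

The cell's statement (planner p2 g37); standard character-sum bookkeeping.  WHAT THIS IS NOT: nothing about the game.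
-/

noncomputable section

namespace Summit.QuantumAdvantage.AdviceFreeQNC0.Exp37

open Finset ZMod
open Literature.Computability.MetaComplexity Literature.Computability.MetaComplexity.ModTestProduct
open Literature.Computability.MetaComplexity.TwoModuli

section Spread

variable {ι : Type*} [Fintype ι] [DecidableEq ι] {κ : Type*} [Fintype κ] [DecidableEq κ]

omit [Fintype ι] [DecidableEq ι] [Fintype κ] [DecidableEq κ] in
/-- `Σ_t ‖a_t‖ ≤ 5/3` for the Fourier coefficients of any sign test (`1/3 + 2/3 + 2/3`, or `1 + 0 + 0`). -/
theorem sum_norm_fcoef_signTest_le (A : Finset (ZMod 3)) : ∑ t : ZMod 3, ‖fcoef (signTest A) t‖ ≤ 5 / 3 := by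
  rw [show (∑ t : ZMod 3, ‖fcoef (signTest A) t‖) =
      ‖fcoef (signTest A) 0‖ + ‖fcoef (signTest A) 1‖ + ‖fcoef (signTest A) 2‖ from Fin.sum_univ_three _]
  by_cases h : A.Nonempty ∧ A ≠ univ
  · rw [fcoef_sign_norm_zero _ (signTest_sign' A) (signTest_nonconst' h.1 h.2),
      fcoef_sign_norm_ne_zero _ (signTest_sign' A) (signTest_nonconst' h.1 h.2) (by decide),
      fcoef_sign_norm_ne_zero _ (signTest_sign' A) (signTest_nonconst' h.1 h.2) (by decide)]
    norm_num
  · obtain ⟨c, hc, hA⟩ := signTest_const_of h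
    rw [hA, fcoef_const, fcoef_const, fcoef_const, if_pos rfl, if_neg (by decide), if_neg (by decide)]
    rcases hc with rfl | rfl <;> simp <;> norm_num

omit [Fintype ι] [DecidableEq ι] [Fintype κ] [DecidableEq κ] in
/-- `Σ_t ‖a_t‖ = 1` for the trivial test `A = ∅`. -/
theorem sum_norm_fcoef_signTest_empty : ∑ t : ZMod 3, ‖fcoef (signTest (∅ : Finset (ZMod 3))) t‖ = 1 := by
  rw [show (∑ t : ZMod 3, ‖fcoef (signTest (∅ : Finset (ZMod 3))) t‖) =
      ‖fcoef (signTest ∅) 0‖ + ‖fcoef (signTest ∅) 1‖ + ‖fcoef (signTest ∅) 2‖ from Fin.sum_univ_three _]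
  have e : signTest (∅ : Finset (ZMod 3)) = fun _ => (1 : ℂ) := by
    funext v; unfold signTest; rw [if_neg (notMem_empty v)]
  rw [e, fcoef_const, fcoef_const, fcoef_const, if_pos rfl, if_neg (by decide), if_neg (by decide)]
  simp

omit [Fintype ι] [DecidableEq ι] in
/-- **`L¹` mass of the coefficients**: `Σ_s ∏_k ‖a_{k,s_k}‖ ≤ (5/3)^{|J|}` when the tests off `J` are trivial. -/
theorem sum_prod_norm_fcoef_le (A : κ → Finset (ZMod 3)) (J : Finset κ) (hJ : ∀ k, k ∉ J → A k = ∅) :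
    ∑ s : κ → ZMod 3, ∏ k, ‖fcoef (signTest (A k)) (s k)‖ ≤ ((5 : ℝ) / 3) ^ J.card := by
  classical
  rw [← Fintype.prod_sum (fun k tk => ‖fcoef (signTest (A k)) tk‖)]
  calc ∏ k, ∑ tk : ZMod 3, ‖fcoef (signTest (A k)) tk‖ ≤ ∏ k, (if k ∈ J then (5 : ℝ) / 3 else 1) := by
        refine prod_le_prod (fun k _ => sum_nonneg fun t _ => norm_nonneg _) fun k _ => ?_
        split_ifs with hk
        · exact sum_norm_fcoef_signTest_le _
        · rw [hJ k hk, sum_norm_fcoef_signTest_empty]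
    _ = ((5 : ℝ) / 3) ^ J.card := by
        rw [prod_ite, prod_const_one, mul_one, prod_const]
        congr 1
        rw [Finset.filter_mem_eq_inter, Finset.univ_inter]

omit [DecidableEq ι] [Fintype κ] [DecidableEq κ] in
/-- Untwisted coin factors: `∏_c ‖1 + χ₃(λ_c)‖ ≤ 2^{|ι|}·2^{−wt λ}`. -/
theorem prod_norm_untwist_le (lam : ι → ZMod 3) :
    ∏ i, ‖(1 : ℂ) + stdAddChar (lam i) * stdAddChar (0 : ZMod 2)‖ ≤ (2 : ℝ) ^ Fintype.card ι * (2 : ℝ)⁻¹ ^ wt lam := by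
  classical
  simp only [AddChar.map_zero_eq_one, mul_one]
  refine (prod_norm_one_add_stdAddChar_three_le lam).trans (le_of_eq ?_)
  have hcard : (univ.filter fun i => lam i = 0).card = Fintype.card ι - wt lam := by
    unfold wt
    have h := card_filter_add_card_filter_not (s := (univ : Finset ι)) (fun i => lam i ≠ 0)
    rw [card_univ] at h
    have e : (univ.filter fun i => ¬ lam i ≠ 0) = univ.filter fun i => lam i = 0 := filter_congr fun i _ => by simp
    rw [e] at h
    omega
  have hwt : wt lam ≤ Fintype.card ι := by unfold wt; exact card_le_univ _
  rw [hcard, inv_pow, pow_sub₀ _ (by norm_num : (2 : ℝ) ≠ 0) hwt]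

omit [DecidableEq ι] [Fintype κ] [DecidableEq κ] in
/-- Twisted coin factors: `∏_c ‖1 + χ₃(λ_c)χ₂(1)‖ ≤ 2^{|ι|}(√3/2)^{|ι|}` (a zero coordinate kills the product). -/
theorem prod_norm_twist_one_le (lam : ι → ZMod 3) :
    ∏ i, ‖(1 : ℂ) + stdAddChar (lam i) * stdAddChar (1 : ZMod 2)‖ ≤
      (2 : ℝ) ^ Fintype.card ι * (Real.sqrt 3 / 2) ^ Fintype.card ι := by
  classical
  by_cases h : ∃ i, lam i = 0
  · obtain ⟨i, hi⟩ := h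
    rw [prod_eq_zero (mem_univ i) (by rw [hi, AddChar.map_zero_eq_one, one_mul, stdAddChar_two_one]; simp)]
    positivity
  · push Not at h
    have hwt : wt lam = Fintype.card ι := by
      unfold wt
      rw [filter_true_of_mem fun i _ => h i, card_univ]
    have hp := prod_norm_twist_le lam 1
    rw [hwt] at hp
    exact hp

/-- **The bound on the twisted sums under (Gen_d)**:
`‖Σ_u (−1)^{#fire(u)} χ₂(t)^{|u|}‖ ≤ 2^{|ι|}·([t = 0](1/3 + (5/3)^{|J|}2^{−d}) + [t = 1](5/3)^{|J|}(√3/2)^{|ι|})`. -/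
theorem norm_twisted_sum_le_of_spread (δ : κ → ι → ZMod 3) (A : κ → Finset (ZMod 3)) (J : Finset κ)
    (hJ : ∀ k, k ∉ J → A k = ∅) (k₀ : κ) (hk₀ : (A k₀).Nonempty) (hk₀' : A k₀ ≠ univ)
    (hι : 0 < Fintype.card ι) {d : ℕ}
    (hd : ∀ s : κ → ZMod 3, s ≠ 0 → (∀ k, k ∉ J → s k = 0) → d ≤ wt (combo δ s))
    (t : ZMod 2) :
    ‖∑ u : ι → Bool, (-1 : ℂ) ^ (univ.filter fun k => subsetSum (δ k) u ∈ A k).card *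
        (stdAddChar t : ℂ) ^ (univ.filter fun i => u i = true).card‖
      ≤ (2 : ℝ) ^ Fintype.card ι *
        (if t = 0 then (1 : ℝ) / 3 + ((5 : ℝ) / 3) ^ J.card * (2 : ℝ)⁻¹ ^ d
          else ((5 : ℝ) / 3) ^ J.card * (Real.sqrt 3 / 2) ^ Fintype.card ι) := by
  classical
  set a : κ → ZMod 3 → ℂ := fun k => fcoef (signTest (A k)) with ha
  have hmain := norm_sum_prod_twist_le δ a (fun k => signTest (A k)) (fun k v => fourier_inversion _ v) t
  simp_rw [prod_signTest_eq] at hmain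
  refine hmain.trans ?_
  set c : (κ → ZMod 3) → ℝ := fun s => ∏ k, ‖a k (s k)‖ with hc
  set S' : Finset (κ → ZMod 3) := univ.filter (fun s : κ → ZMod 3 => s ≠ 0 ∧ ∀ k, k ∉ J → s k = 0) with hS'
  have hc_nonneg : ∀ s, 0 ≤ c s := fun s => prod_nonneg fun k _ => norm_nonneg _
  have hc_zero : ∀ s : κ → ZMod 3, s ≠ 0 → s ∉ S' → c s = 0 := by
    intro s hs0 hs
    have : ¬ ∀ k, k ∉ J → s k = 0 := fun h => hs (mem_filter.2 ⟨mem_univ _, hs0, h⟩)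
    push Not at this
    obtain ⟨k, hkJ, hsk⟩ := this
    refine prod_eq_zero (mem_univ k) ?_
    rw [ha]; dsimp only
    rw [hJ k hkJ, fcoef_signTest_empty hsk, norm_zero]
  have hc0 : c 0 ≤ 1 / 3 := by
    rw [hc]; dsimp only
    rw [← mul_prod_erase univ _ (mem_univ k₀)]
    have h1 : ‖a k₀ ((0 : κ → ZMod 3) k₀)‖ = 1 / 3 := by
      rw [ha]; exact fcoef_sign_norm_zero _ (signTest_sign' _) (signTest_nonconst' hk₀ hk₀')
    rw [h1]
    have h2 : ∏ k ∈ univ.erase k₀, ‖a k ((0 : κ → ZMod 3) k)‖ ≤ 1 := by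
      calc ∏ k ∈ univ.erase k₀, ‖a k ((0 : κ → ZMod 3) k)‖ ≤ ∏ k ∈ univ.erase k₀, (1 : ℝ) :=
            prod_le_prod (fun k _ => norm_nonneg _) fun k _ => norm_fcoef_signTest_le_one _ _
        _ = 1 := prod_const_one
    linarith [mul_le_mul_of_nonneg_left h2 (by norm_num : (0 : ℝ) ≤ 1 / 3)]
  -- `L¹` mass of the surviving coefficients
  have hmass : ∑ s ∈ S', c s ≤ ((5 : ℝ) / 3) ^ J.card :=
    le_trans (sum_le_sum_of_subset_of_nonneg (filter_subset _ _) fun s _ _ => hc_nonneg s)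
      (sum_prod_norm_fcoef_le A J hJ)
  -- split off the zero pattern; the rest is `S'`
  have hsplit : ∑ s : κ → ZMod 3, c s * ∏ i, ‖(1 : ℂ) + stdAddChar (combo δ s i) * stdAddChar t‖
      = c 0 * ∏ i, ‖(1 : ℂ) + stdAddChar (combo δ 0 i) * stdAddChar t‖ +
        ∑ s ∈ S', c s * ∏ i, ‖(1 : ℂ) + stdAddChar (combo δ s i) * stdAddChar t‖ := by
    rw [← sum_erase_add _ _ (mem_univ (0 : κ → ZMod 3)), add_comm]
    congr 1
    symm
    refine sum_subset (fun s hs => mem_erase.2 ⟨(mem_filter.1 hs).2.1, mem_univ _⟩) fun s hs hs' => ?_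
    rw [hc_zero s (ne_of_mem_erase hs) hs', zero_mul]
  have hcombo0 : combo δ (0 : κ → ZMod 3) = 0 := by
    funext i; unfold combo; simp
  rw [show (∑ s : κ → ZMod 3, (∏ k, ‖a k (s k)‖) * ∏ i, ‖(1 : ℂ) + stdAddChar (combo δ s i) * stdAddChar t‖)
      = ∑ s : κ → ZMod 3, c s * ∏ i, ‖(1 : ℂ) + stdAddChar (combo δ s i) * stdAddChar t‖ from rfl, hsplit, hcombo0]
  have ht01 : ∀ t' : ZMod 2, t' = 0 ∨ t' = 1 := by decide
  rcases ht01 t with rfl | rfl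
  · -- untwisted
    rw [if_pos rfl]
    have hS'le : ∑ s ∈ S', c s * ∏ i, ‖(1 : ℂ) + stdAddChar (combo δ s i) * stdAddChar (0 : ZMod 2)‖
        ≤ (2 : ℝ) ^ Fintype.card ι * (((5 : ℝ) / 3) ^ J.card * (2 : ℝ)⁻¹ ^ d) := by
      calc ∑ s ∈ S', c s * ∏ i, ‖(1 : ℂ) + stdAddChar (combo δ s i) * stdAddChar (0 : ZMod 2)‖
          ≤ ∑ s ∈ S', c s * ((2 : ℝ) ^ Fintype.card ι * (2 : ℝ)⁻¹ ^ d) := by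
            refine sum_le_sum fun s hs => mul_le_mul_of_nonneg_left ?_ (hc_nonneg s)
            obtain ⟨-, hs0, hsJ⟩ := mem_filter.1 hs
            refine (prod_norm_untwist_le _).trans (mul_le_mul_of_nonneg_left ?_ (by positivity))
            exact pow_le_pow_of_le_one (by norm_num) (by norm_num) (hd s hs0 hsJ)
        _ = (2 : ℝ) ^ Fintype.card ι * (2 : ℝ)⁻¹ ^ d * ∑ s ∈ S', c s := by rw [mul_sum]; exact sum_congr rfl fun s _ => by ring
        _ ≤ (2 : ℝ) ^ Fintype.card ι * (2 : ℝ)⁻¹ ^ d * ((5 : ℝ) / 3) ^ J.card :=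
            mul_le_mul_of_nonneg_left hmass (by positivity)
        _ = _ := by ring
    have h0le : c 0 * ∏ i : ι, ‖(1 : ℂ) + stdAddChar ((0 : ι → ZMod 3) i) * stdAddChar (0 : ZMod 2)‖
        ≤ (2 : ℝ) ^ Fintype.card ι * ((1 : ℝ) / 3) := by
      have hprod : ∏ i : ι, ‖(1 : ℂ) + stdAddChar ((0 : ι → ZMod 3) i) * stdAddChar (0 : ZMod 2)‖
          = (2 : ℝ) ^ Fintype.card ι := by
        simp only [Pi.zero_apply, AddChar.map_zero_eq_one, mul_one]
        rw [prod_const, card_univ]; norm_num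
      rw [hprod, mul_comm]
      exact mul_le_mul_of_nonneg_left hc0 (by positivity)
    calc _ ≤ (2 : ℝ) ^ Fintype.card ι * ((1 : ℝ) / 3) + (2 : ℝ) ^ Fintype.card ι * (((5 : ℝ) / 3) ^ J.card * (2 : ℝ)⁻¹ ^ d) :=
          add_le_add h0le hS'le
      _ = _ := by ring
  · -- twisted
    rw [if_neg (by decide)]
    have hS'le : ∑ s ∈ S', c s * ∏ i, ‖(1 : ℂ) + stdAddChar (combo δ s i) * stdAddChar (1 : ZMod 2)‖
        ≤ (2 : ℝ) ^ Fintype.card ι * (((5 : ℝ) / 3) ^ J.card * (Real.sqrt 3 / 2) ^ Fintype.card ι) := by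
      calc ∑ s ∈ S', c s * ∏ i, ‖(1 : ℂ) + stdAddChar (combo δ s i) * stdAddChar (1 : ZMod 2)‖
          ≤ ∑ s ∈ S', c s * ((2 : ℝ) ^ Fintype.card ι * (Real.sqrt 3 / 2) ^ Fintype.card ι) :=
            sum_le_sum fun s _ => mul_le_mul_of_nonneg_left (prod_norm_twist_one_le _) (hc_nonneg s)
        _ = (2 : ℝ) ^ Fintype.card ι * (Real.sqrt 3 / 2) ^ Fintype.card ι * ∑ s ∈ S', c s := by
            rw [mul_sum]; exact sum_congr rfl fun s _ => by ring
        _ ≤ (2 : ℝ) ^ Fintype.card ι * (Real.sqrt 3 / 2) ^ Fintype.card ι * ((5 : ℝ) / 3) ^ J.card :=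
            mul_le_mul_of_nonneg_left hmass (by positivity)
        _ = _ := by ring
    have h0le : c 0 * ∏ i : ι, ‖(1 : ℂ) + stdAddChar ((0 : ι → ZMod 3) i) * stdAddChar (1 : ZMod 2)‖ = 0 := by
      simp only [Pi.zero_apply]
      rw [prod_norm_twist_zero hι, mul_zero]
    rw [h0le, zero_add]
    exact hS'le

/-- **STEP 3 under (Gen_d) (the parity-class count, `L¹` form).**  On the parity class `{u : |u| ≡ p}` the number of firing
tests has parity `c` for at most `(3/4)·2^{|ι|−1}` points. -/
theorem card_parityClass_filter_le_of_spread (δ : κ → ι → ZMod 3) (A : κ → Finset (ZMod 3)) (J : Finset κ)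
    (hJ : ∀ k, k ∉ J → A k = ∅) (k₀ : κ) (hk₀ : (A k₀).Nonempty) (hk₀' : A k₀ ≠ univ)
    (hι : 0 < Fintype.card ι) {d : ℕ}
    (hd : ∀ s : κ → ZMod 3, s ≠ 0 → (∀ k, k ∉ J → s k = 0) → d ≤ wt (combo δ s))
    (hnum : ((5 : ℝ) / 3) ^ J.card * ((2 : ℝ)⁻¹ ^ d + (Real.sqrt 3 / 2) ^ Fintype.card ι) ≤ 1 / 20)
    (p c : ℕ) :
    ((univ.filter fun u : ι → Bool =>
        (univ.filter fun i => u i = true).card % 2 = p % 2 ∧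
        (univ.filter fun k => subsetSum (δ k) u ∈ A k).card % 2 = c % 2).card : ℝ)
      ≤ 3 / 4 * (2 : ℝ) ^ (Fintype.card ι - 1) := by
  classical
  set wtu : (ι → Bool) → ℕ := fun u => (univ.filter fun i => u i = true).card with hwtu
  set N : (ι → Bool) → ℕ := fun u => (univ.filter fun k => subsetSum (δ k) u ∈ A k).card with hN
  set E : Finset (ι → Bool) := univ.filter fun u => wtu u % 2 = p % 2 with hE
  set R : ℝ := ∑ u ∈ E, (-1 : ℝ) ^ N u with hR
  have hT := fun t => norm_twisted_sum_le_of_spread δ A J hJ k₀ hk₀ hk₀' hι hd t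
  have hRC : ((R : ℝ) : ℂ) = ∑ u ∈ E, (-1 : ℂ) ^ N u := by
    rw [hR]; push_cast; rfl
  have hRid : (∑ u : ι → Bool, (-1 : ℂ) ^ N u * (stdAddChar (0 : ZMod 2) : ℂ) ^ wtu u) +
      (-1 : ℂ) ^ p * (∑ u : ι → Bool, (-1 : ℂ) ^ N u * (stdAddChar (1 : ZMod 2) : ℂ) ^ wtu u) =
      2 * ∑ u ∈ E, (-1 : ℂ) ^ N u := by
    rw [AddChar.map_zero_eq_one, stdAddChar_two_one, mul_sum, ← sum_add_distrib,
      ← sum_filter_add_sum_filter_not univ (fun u : ι → Bool => wtu u % 2 = p % 2)]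
    have hon : ∀ u ∈ univ.filter (fun u : ι → Bool => wtu u % 2 = p % 2),
        (-1 : ℂ) ^ N u * (1 : ℂ) ^ wtu u + (-1 : ℂ) ^ p * ((-1 : ℂ) ^ N u * (-1 : ℂ) ^ wtu u) =
          2 * (-1 : ℂ) ^ N u := by
      intro u hu
      have h := (mem_filter.1 hu).2
      have hsgn := neg_one_pow_mul_neg_one_pow p (wtu u)
      rw [if_pos (by omega)] at hsgn
      have hsgnC : ((-1 : ℂ) ^ p) * (-1) ^ wtu u = 1 := by exact_mod_cast hsgn
      rw [one_pow]
      linear_combination ((-1 : ℂ) ^ N u) * hsgnC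
    have hoff : ∀ u ∈ univ.filter (fun u : ι → Bool => ¬ wtu u % 2 = p % 2),
        (-1 : ℂ) ^ N u * (1 : ℂ) ^ wtu u + (-1 : ℂ) ^ p * ((-1 : ℂ) ^ N u * (-1 : ℂ) ^ wtu u) = 0 := by
      intro u hu
      have h := (mem_filter.1 hu).2
      have hsgn := neg_one_pow_mul_neg_one_pow p (wtu u)
      rw [if_neg (by omega)] at hsgn
      have hsgnC : ((-1 : ℂ) ^ p) * (-1) ^ wtu u = -1 := by exact_mod_cast hsgn
      rw [one_pow]
      linear_combination ((-1 : ℂ) ^ N u) * hsgnC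
    rw [sum_congr rfl hon, sum_congr rfl hoff, sum_const_zero, add_zero, ← mul_sum]
  have hRabs : 2 * |R| ≤ (2 : ℝ) ^ Fintype.card ι * (1 / 3 + 1 / 20) := by
    have h : ‖(2 : ℂ) * ((R : ℝ) : ℂ)‖ = ‖(∑ u : ι → Bool, (-1 : ℂ) ^ N u * (stdAddChar (0 : ZMod 2) : ℂ) ^ wtu u) +
        (-1 : ℂ) ^ p * (∑ u : ι → Bool, (-1 : ℂ) ^ N u * (stdAddChar (1 : ZMod 2) : ℂ) ^ wtu u)‖ := by
      rw [hRid, hRC]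
    rw [norm_mul, Complex.norm_real, Real.norm_eq_abs] at h
    have h2 : ‖(2 : ℂ)‖ = 2 := by simp
    rw [h2] at h
    rw [h]
    refine (norm_add_le _ _).trans ?_
    rw [norm_mul]
    have hp1 : ‖(-1 : ℂ) ^ p‖ = 1 := by simp
    rw [hp1, one_mul]
    have h0 := hT 0
    have h1 := hT 1
    rw [if_pos rfl] at h0
    rw [if_neg (by decide)] at h1
    have hpos : (0 : ℝ) ≤ (2 : ℝ) ^ Fintype.card ι := by positivity
    nlinarith [h0, h1, hnum, hpos]
  have hEcard : (E.card : ℝ) = (2 : ℝ) ^ (Fintype.card ι - 1) := card_parityClass hι p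
  have hsplit := card_filter_add_card_filter_not (s := E) (fun u => N u % 2 = 0)
  have hpos : ∀ u ∈ E.filter (fun u => N u % 2 = 0), (-1 : ℝ) ^ N u = 1 :=
    fun u hu => (Nat.even_iff.2 (mem_filter.1 hu).2).neg_one_pow
  have hneg : ∀ u ∈ E.filter (fun u => ¬ N u % 2 = 0), (-1 : ℝ) ^ N u = -1 :=
    fun u hu => (Nat.odd_iff.2 (by have := (mem_filter.1 hu).2; omega)).neg_one_pow
  have hRsplit : R = ((E.filter fun u => N u % 2 = 0).card : ℝ) - ((E.filter fun u => ¬ N u % 2 = 0).card : ℝ) := by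
    rw [hR, ← sum_filter_add_sum_filter_not E (fun u => N u % 2 = 0), sum_congr rfl hpos, sum_congr rfl hneg]
    simp [sub_eq_add_neg]
  have hpow : (2 : ℝ) ^ Fintype.card ι = 2 * (2 : ℝ) ^ (Fintype.card ι - 1) := by
    rw [← pow_succ']; congr 1; omega
  have htarget : (univ.filter fun u : ι → Bool => wtu u % 2 = p % 2 ∧ N u % 2 = c % 2) =
      E.filter fun u => N u % 2 = c % 2 := by
    rw [hE, filter_filter]
  rw [htarget]
  have hsplitR : ((E.filter fun u => N u % 2 = 0).card : ℝ) + ((E.filter fun u => ¬ N u % 2 = 0).card : ℝ)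
      = E.card := by exact_mod_cast hsplit
  rcases Nat.mod_two_eq_zero_or_one c with hc | hc
  · rw [hc]
    have habs := le_abs_self R
    linarith
  · rw [hc]
    have e : (E.filter fun u => N u % 2 = 1) = E.filter fun u => ¬ N u % 2 = 0 :=
      filter_congr fun u _ => by omega
    rw [e]
    have habs := neg_abs_le R
    linarith

end Spread

end Summit.QuantumAdvantage.AdviceFreeQNC0.Exp37

end
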